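import Mathlib
import HarnessLib

/-!
# S2β · `hFlat` road, brick (G7) of UV3-NODE §57.8 (A)∕(C)(3) — THE TENT COVERAGE COUNT: averaging the filled flat squares `□_N(x)` over the
# `N³` points of a corner block covers each fine plaquette of the `(2N−1)²×N` column with weight `c(s₁)c(s₂)∕N³` (`c` = the 1-D tent, `c ≤ N`,
# `Σ c = N²`, `Σ c² ≤ N³`), hence `E_x[Σ_{p ∈ □_N(x)} g(p)] ≤ √N · ‖g‖_{ℓ²(column)}` — the `√N = L^{t∕2}` of the KEY LEMMA

Cell `ym3-torus` (rung R3 = continuum `SU(2)` Yang–Mills on the three-torus — NOT d = 4, NOT infinite volume, NOT a mass gap, NOT Clay).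
Width seat «width 8» `ym3-torus-px8` (gen 21), FREE px helper on crux `stmt-QuantumFields-20520`, count-neutral, DEFINITION-FREE, Mathlib-only.

WHY (UV3-NODE §57.8 (A), (C)(3)).  After coupling (✓`…CouplingIdentity`, ✓`…CouplingCost`) the logarithm of a level-`t` plaquette holonomy is the mean over the
`N³` corner-block points `x` (`N = L^t`) of `log U(□_N(x))`, `□_N(x)` the SHARP flat square of side `N` with corner `x`, plus chargeable junk; lasso Stokes
(✓`…CornerSquareStokes`, ✓`…ReorderLoopStokes`) gives `dist1 U(□_N(x)) ≤ Σ_{p ∈ filled □_N(x)} dist1 U(∂p)`.  In local column coordinates the filled square of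
`x = (x₁, x₂; h)` is the window `[x₁, x₁+N) × [x₂, x₂+N)` at height `h`; exchanging the sums produces the TENT weights and Cauchy–Schwarz the `√N`:
* §1 (one dimension) `sum_range_sum_Ico_eq` (★ exchange: `Σ_{x<N} Σ_{s∈[x,x+N)} f s = Σ_{s<2N−1} c(s)•f s`, `c(s) = #{x < N : x ≤ s < x+N}`), `cover_card_le` (`c ≤ N`),
  `sum_cover_card_eq` (`Σ c = N²`), `sum_cover_card_sq_le` (`Σ c² ≤ N³`; the exact value `N(2N²+1)∕3` is not needed);
* §2 (the plane) ★ `sum_window_eq` (`Σ_{x₁,x₂<N} Σ_{window} g = Σ_{s₁,s₂<2N−1} c(s₁)c(s₂)·g s₁ s₂`), ★★ `sum_window_le` (`≤ N³·√(Σ_{s₁,s₂<2N−1} g²)`);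
* §3 (the block) ★★ `blockMean_window_sum_le` : `(N³)⁻¹·Σ_{h<N} Σ_{x₁,x₂<N} Σ_{window} g h s₁ s₂ ≤ √N·√(Σ_{h<N} Σ_{s₁,s₂<2N−1} (g h s₁ s₂)²)`.

HONEST SCOPE.  Finite sums over `Finset.range`∕`Finset.Ico` and Mathlib's Cauchy–Schwarz (`Real.sum_mul_le_sqrt_mul_sqrt`); the docking to the `Setup` torus (local
column coordinates around a coarse plaquette, the flat squares in the plane `μν`) is the assembler's; nothing of Bałaban's analysis; the nonabelian KEY LEMMA, the
recursion, `hFlat`, TUBE-REG∘, GAP♯∘, S2β, crux 20520 and `YM3TorusSU2` are NOT proved; no registered stub is closed; the Yang–Mills mass gap is NOT proved.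
References: T. Bałaban, CMP **99** (1985) 75–102 [Balaban1985RegularSpaces] (block averaging geometry); T. Bałaban, CMP **96** (1984) [Balaban1984PropagatorsII].
-/

set_option autoImplicit false

noncomputable section

open Finset
open scoped BigOperators

namespace Summit.QuantumFields.YangMills.Theorems.FluctuationComparisonRegPrIntLS2BetaTentCoverage

/-! ## §1 One dimension: the tent count -/

/-- ★ **EXCHANGE OF SUMS (one dimension)**: `Σ_{x<N} Σ_{s ∈ [x, x+N)} f s = Σ_{s<2N−1} c(s) • f s` with the TENT COUNT
`c(s) = #{x < N : x ≤ s < x + N}`. [folklore] -/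
theorem sum_range_sum_Ico_eq {M : Type*} [AddCommMonoid M] (N : ℕ) (f : ℕ → M) :
    ∑ x ∈ range N, ∑ s ∈ Ico x (x + N), f s =
      ∑ s ∈ range (2 * N - 1), ((range N).filter (fun x => x ≤ s ∧ s < x + N)).card • f s := by
  have h1 : ∀ x ∈ range N, ∑ s ∈ Ico x (x + N), f s = ∑ s ∈ range (2 * N - 1), if x ≤ s ∧ s < x + N then f s else 0 := by
    intro x hx
    rw [mem_range] at hx
    rw [← Finset.sum_filter]
    congr 1
    ext s
    simp only [mem_Ico, mem_filter, mem_range]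
    omega
  rw [Finset.sum_congr rfl h1, Finset.sum_comm]
  refine Finset.sum_congr rfl fun s _ => ?_
  rw [← Finset.sum_filter, Finset.sum_const]

/-- The same over `ℝ`: `Σ_{x<N} Σ_{s ∈ [x, x+N)} f s = Σ_{s<2N−1} c(s)·f s`. [folklore] -/
theorem sum_range_sum_Ico_eq_real (N : ℕ) (f : ℕ → ℝ) :
    ∑ x ∈ range N, ∑ s ∈ Ico x (x + N), f s =
      ∑ s ∈ range (2 * N - 1), (((range N).filter (fun x => x ≤ s ∧ s < x + N)).card : ℝ) * f s := by
  rw [sum_range_sum_Ico_eq]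
  simp only [nsmul_eq_mul]

/-- `c(s) ≤ N`. [folklore] -/
theorem cover_card_le (N s : ℕ) : ((range N).filter (fun x => x ≤ s ∧ s < x + N)).card ≤ N :=
  (card_filter_le _ _).trans (card_range N).le

/-- `Σ_{s<2N−1} c(s) = N²` (each of the `N` windows has `N` points). [folklore] -/
theorem sum_cover_card_eq (N : ℕ) : ∑ s ∈ range (2 * N - 1), ((range N).filter (fun x => x ≤ s ∧ s < x + N)).card = N ^ 2 := by
  have h := sum_range_sum_Ico_eq (M := ℕ) N (fun _ => 1)
  simp only [sum_const, Nat.card_Ico, smul_eq_mul, mul_one, add_tsub_cancel_left, card_range] at h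
  rw [← h, sq]

/-- `Σ_{s<2N−1} c(s)² ≤ N³` (`c ≤ N` pointwise and `Σ c = N²`). [folklore] -/
theorem sum_cover_card_sq_le (N : ℕ) : ∑ s ∈ range (2 * N - 1), ((range N).filter (fun x => x ≤ s ∧ s < x + N)).card ^ 2 ≤ N ^ 3 := by
  calc ∑ s ∈ range (2 * N - 1), ((range N).filter (fun x => x ≤ s ∧ s < x + N)).card ^ 2
      ≤ ∑ s ∈ range (2 * N - 1), N * ((range N).filter (fun x => x ≤ s ∧ s < x + N)).card :=
        Finset.sum_le_sum fun s _ => by rw [sq]; exact Nat.mul_le_mul_right _ (cover_card_le N s)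
    _ = N * N ^ 2 := by rw [← Finset.mul_sum, sum_cover_card_eq]
    _ = N ^ 3 := by ring

/-- The same over `ℝ`. [folklore] -/
theorem sum_cover_card_sq_le_real (N : ℕ) :
    ∑ s ∈ range (2 * N - 1), ((((range N).filter (fun x => x ≤ s ∧ s < x + N)).card : ℝ)) ^ 2 ≤ (N : ℝ) ^ 3 := by
  exact_mod_cast sum_cover_card_sq_le N

/-! ## §2 The plane: windows `[x₁, x₁+N) × [x₂, x₂+N)` -/

/-- ★ **EXCHANGE OF SUMS (the plane)**: `Σ_{x₁,x₂<N} Σ_{s₁∈[x₁,x₁+N)} Σ_{s₂∈[x₂,x₂+N)} g s₁ s₂ = Σ_{s₁,s₂<2N−1} c(s₁)·c(s₂)·g s₁ s₂`. [folklore] -/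
theorem sum_window_eq (N : ℕ) (g : ℕ → ℕ → ℝ) :
    ∑ x₁ ∈ range N, ∑ x₂ ∈ range N, ∑ s₁ ∈ Ico x₁ (x₁ + N), ∑ s₂ ∈ Ico x₂ (x₂ + N), g s₁ s₂ =
      ∑ s₁ ∈ range (2 * N - 1), ∑ s₂ ∈ range (2 * N - 1),
        (((range N).filter (fun x => x ≤ s₁ ∧ s₁ < x + N)).card : ℝ) *
          ((((range N).filter (fun x => x ≤ s₂ ∧ s₂ < x + N)).card : ℝ) * g s₁ s₂) := by
  have hin : ∀ x₁ ∈ range N, ∑ x₂ ∈ range N, ∑ s₁ ∈ Ico x₁ (x₁ + N), ∑ s₂ ∈ Ico x₂ (x₂ + N), g s₁ s₂ =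
      ∑ s₁ ∈ Ico x₁ (x₁ + N), ∑ s₂ ∈ range (2 * N - 1), (((range N).filter (fun x => x ≤ s₂ ∧ s₂ < x + N)).card : ℝ) * g s₁ s₂ := by
    intro x₁ _
    rw [Finset.sum_comm]
    exact Finset.sum_congr rfl fun s₁ _ => sum_range_sum_Ico_eq_real N (g s₁)
  rw [Finset.sum_congr rfl hin, sum_range_sum_Ico_eq_real]
  refine Finset.sum_congr rfl fun s₁ _ => ?_
  rw [Finset.mul_sum]

/-- ★★ **THE WINDOW SUM BY CAUCHY–SCHWARZ (the plane)**: `Σ_{x₁,x₂<N} Σ_{window} g ≤ N³·√(Σ_{s₁,s₂<2N−1} g²)` (tent weights `c(s₁)c(s₂)`,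
`Σ (c₁c₂)² = (Σc²)² ≤ N⁶`). [folklore] -/
theorem sum_window_le (N : ℕ) (g : ℕ → ℕ → ℝ) :
    ∑ x₁ ∈ range N, ∑ x₂ ∈ range N, ∑ s₁ ∈ Ico x₁ (x₁ + N), ∑ s₂ ∈ Ico x₂ (x₂ + N), g s₁ s₂ ≤
      (N : ℝ) ^ 3 * √(∑ s₁ ∈ range (2 * N - 1), ∑ s₂ ∈ range (2 * N - 1), g s₁ s₂ ^ 2) := by
  rw [sum_window_eq]
  set c : ℕ → ℝ := fun s => (((range N).filter (fun x => x ≤ s ∧ s < x + N)).card : ℝ) with hc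
  have hflat : ∑ s₁ ∈ range (2 * N - 1), ∑ s₂ ∈ range (2 * N - 1), c s₁ * (c s₂ * g s₁ s₂) =
      ∑ p ∈ range (2 * N - 1) ×ˢ range (2 * N - 1), (c p.1 * c p.2) * g p.1 p.2 := by
    rw [Finset.sum_product]
    exact Finset.sum_congr rfl fun s₁ _ => Finset.sum_congr rfl fun s₂ _ => by ring
  have hg : ∑ s₁ ∈ range (2 * N - 1), ∑ s₂ ∈ range (2 * N - 1), g s₁ s₂ ^ 2 =
      ∑ p ∈ range (2 * N - 1) ×ˢ range (2 * N - 1), g p.1 p.2 ^ 2 := by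
    rw [Finset.sum_product]
  have hCS := Real.sum_mul_le_sqrt_mul_sqrt (range (2 * N - 1) ×ˢ range (2 * N - 1)) (fun p => c p.1 * c p.2) (fun p => g p.1 p.2)
  have hw : ∑ p ∈ range (2 * N - 1) ×ˢ range (2 * N - 1), (c p.1 * c p.2) ^ 2 ≤ ((N : ℝ) ^ 3) ^ 2 := by
    have h1 : ∑ s ∈ range (2 * N - 1), c s ^ 2 ≤ (N : ℝ) ^ 3 := sum_cover_card_sq_le_real N
    have h0 : 0 ≤ ∑ s ∈ range (2 * N - 1), c s ^ 2 := Finset.sum_nonneg fun s _ => sq_nonneg _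
    calc ∑ p ∈ range (2 * N - 1) ×ˢ range (2 * N - 1), (c p.1 * c p.2) ^ 2
        = (∑ s ∈ range (2 * N - 1), c s ^ 2) * ∑ s ∈ range (2 * N - 1), c s ^ 2 := by
          rw [Finset.sum_product, Finset.sum_mul_sum]
          exact Finset.sum_congr rfl fun s₁ _ => Finset.sum_congr rfl fun s₂ _ => by ring
      _ ≤ (N : ℝ) ^ 3 * (N : ℝ) ^ 3 := mul_le_mul h1 h1 h0 (by positivity)
      _ = ((N : ℝ) ^ 3) ^ 2 := by ring
  have hsq : √(∑ p ∈ range (2 * N - 1) ×ˢ range (2 * N - 1), (c p.1 * c p.2) ^ 2) ≤ (N : ℝ) ^ 3 := by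
    rw [← Real.sqrt_sq (show (0 : ℝ) ≤ (N : ℝ) ^ 3 by positivity)]
    exact Real.sqrt_le_sqrt hw
  rw [hflat, hg]
  calc ∑ p ∈ range (2 * N - 1) ×ˢ range (2 * N - 1), c p.1 * c p.2 * g p.1 p.2
      ≤ √(∑ p ∈ range (2 * N - 1) ×ˢ range (2 * N - 1), (c p.1 * c p.2) ^ 2) *
          √(∑ p ∈ range (2 * N - 1) ×ˢ range (2 * N - 1), g p.1 p.2 ^ 2) := hCS
    _ ≤ (N : ℝ) ^ 3 * √(∑ p ∈ range (2 * N - 1) ×ˢ range (2 * N - 1), g p.1 p.2 ^ 2) :=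
        mul_le_mul_of_nonneg_right hsq (Real.sqrt_nonneg _)

/-! ## §3 The block: heights `h < N`, normalisation `N⁻³`, the `√N` -/

/-- ★★ **THE TENT COVERAGE BOUND**: averaging over the `N³` points `x = (x₁, x₂; h)` of the corner block the sum of `g` over the filled flat square of `x`
(the window `[x₁,x₁+N)×[x₂,x₂+N)` at height `h`) is at most `√N` times the `ℓ²` norm of `g` over the `(2N−1)²×N` column:
`(N³)⁻¹·Σ_{h<N} Σ_{x₁,x₂<N} Σ_{window} g h s₁ s₂ ≤ √N·√(Σ_{h<N} Σ_{s₁,s₂<2N−1} (g h s₁ s₂)²)` — with `g` = fine plaquette `dist1` and lasso Stokes this is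
`E_x dist1 U(□_N(x)) ≤ √N·‖f‖_{column}`, the `√N = L^{t∕2}` of the KEY LEMMA of UV3-NODE §57.8 (C). [cite: Balaban1985RegularSpaces, §1 (block averaging geometry)] -/
theorem blockMean_window_sum_le (N : ℕ) (hN : 0 < N) (g : ℕ → ℕ → ℕ → ℝ) :
    ((N : ℝ) ^ 3)⁻¹ * ∑ h ∈ range N, ∑ x₁ ∈ range N, ∑ x₂ ∈ range N, ∑ s₁ ∈ Ico x₁ (x₁ + N), ∑ s₂ ∈ Ico x₂ (x₂ + N), g h s₁ s₂ ≤
      Real.sqrt N * √(∑ h ∈ range N, ∑ s₁ ∈ range (2 * N - 1), ∑ s₂ ∈ range (2 * N - 1), g h s₁ s₂ ^ 2) := by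
  have hN' : (0 : ℝ) < (N : ℝ) ^ 3 := by positivity
  set E : ℕ → ℝ := fun h => ∑ s₁ ∈ range (2 * N - 1), ∑ s₂ ∈ range (2 * N - 1), g h s₁ s₂ ^ 2 with hE
  have hE0 : ∀ h, 0 ≤ E h := fun h => Finset.sum_nonneg fun _ _ => Finset.sum_nonneg fun _ _ => sq_nonneg _
  -- plane by plane
  have hplane : ∑ h ∈ range N, ∑ x₁ ∈ range N, ∑ x₂ ∈ range N, ∑ s₁ ∈ Ico x₁ (x₁ + N), ∑ s₂ ∈ Ico x₂ (x₂ + N), g h s₁ s₂ ≤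
      ∑ h ∈ range N, (N : ℝ) ^ 3 * √(E h) := Finset.sum_le_sum fun h _ => sum_window_le N (g h)
  -- Cauchy–Schwarz over the heights: `Σ_{h<N} 1·√(E h) ≤ √N·√(Σ E)`
  have hCS := Real.sum_mul_le_sqrt_mul_sqrt (range N) (fun _ => (1 : ℝ)) (fun h => √(E h))
  simp only [one_mul, one_pow, sum_const, card_range, nsmul_eq_mul, mul_one] at hCS
  have hsq : ∑ h ∈ range N, √(E h) ^ 2 = ∑ h ∈ range N, E h := Finset.sum_congr rfl fun h _ => Real.sq_sqrt (hE0 h)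
  rw [hsq] at hCS
  calc ((N : ℝ) ^ 3)⁻¹ * ∑ h ∈ range N, ∑ x₁ ∈ range N, ∑ x₂ ∈ range N, ∑ s₁ ∈ Ico x₁ (x₁ + N), ∑ s₂ ∈ Ico x₂ (x₂ + N), g h s₁ s₂
      ≤ ((N : ℝ) ^ 3)⁻¹ * ∑ h ∈ range N, (N : ℝ) ^ 3 * √(E h) := mul_le_mul_of_nonneg_left hplane (inv_nonneg.mpr hN'.le)
    _ = ∑ h ∈ range N, √(E h) := by rw [← Finset.mul_sum, inv_mul_cancel_left₀ hN'.ne']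
    _ ≤ Real.sqrt N * √(∑ h ∈ range N, E h) := hCS

end Summit.QuantumFields.YangMills.Theorems.FluctuationComparisonRegPrIntLS2BetaTentCoverage

end
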